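import Mathlib
import HarnessLib
import Summits.Ventures.LatticeQCDFlow.Scoring.KernelAdmissibleClass
import Summits.Ventures.LatticeQCDFlow.Scoring.AdjointKernelAutocovariance
import Summits.Ventures.LatticeQCDFlow.Exactness.NonreversibleDirichletComparison

/-!
# A NON-REVERSIBLE kernel never scores worse than its additive reversibilization `½(κ + κ†)`, nor than any reversible kernel it dominates in Dirichlet form — on a general state space, for every bounded observable; forward sweeps beat direction-randomised sweeps

HONEST FRAMING: exact (Metropolis-corrected) sampling algorithms for lattice gauge theory;
figures of merit are autocorrelation/cost numbers at stated couplings and volumes; no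
continuum-physics claim.

Venture `LatticeQCDFlow` (cell pub-lqcd), topic `Scoring`; FANOUT row 8 (`s0-cpn-nemc`, GEN-24).
NEW WORK of the cell: the kernel-level form of `RevOp.abelSum_le_of_quadForm_le_nonrev`
(`Exactness/NonreversibleDirichletComparison`) through the bridge `Scoring/KernelAdmissibleClass`
(bounded measurable observables of a Markov kernel with invariant probability law are an admissible
class) and the adjoint-pair toolkit `Scoring/AdjointKernelAutocovariance` (`½(κ + κ†) = mixtureKernel`,
reversible, same Dirichlet form; `isAdjointPair_cycle_reverse` of row 9).  Nothing is cited as a fact.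
Printed counterparts NAMED ONLY: Sun–Gomez–Schmidhuber 2010, Bierkens 2016 Prop. 3.1 (finite state
space; PROVED in `Literature/Probability/MarkovChains/AdditiveReversibilizationVariance`), Neal 2004
(non-reversible chains built from reversible pieces are never worse).

## Content (`π` a probability law, `κ` Markov with `Kernel.Invariant κ π`; `g, v` bounded measurable;
## `C_g(t) = autocov κ π g t = ∫ g (kop κ)^[t] g dπ`; `0 ≤ r < 1`)

* **`abelSum_autocov_nonneg`** — `0 ≤ Σ_k autocov κ π g k · rᵏ` for EVERY invariant Markov kernel;
* **`abelSum_autocov_le_of_form_le`** — `σ` `π`-reversible Markov with `∫ v (kop κ v) dπ ≤ ∫ v (kop σ v) dπ`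
  for all bounded measurable `v` ⇒ `Σ_k autocov κ π g k rᵏ ≤ Σ_k autocov σ π g k rᵏ`;
  **`tauInt_le_of_form_le`** — under summability of both normalised series and `∫ g² dπ > 0`:
  `τ_int(g; κ) ≤ τ_int(g; σ)` (`Scoring.tauInt`);
* **`abelSum_autocov_le_addReversibilization`**, **`tauInt_le_addReversibilization`** — `κ'` a Markov
  `π`-adjoint of `κ` (`IsAdjointPair κ κ' π`), `(t : ℝ) = ½`: `κ` never scores worse than
  `mixtureKernel t κ κ' = ½(κ + κ†)`, observable by observable;
* **`abelSum_autocov_cycle_le_directionMixture`**, **`tauInt_cycle_le_directionMixture`** — for every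
  list of `π`-reversible Markov kernels: the FORWARD sweep `cycle Ks` never scores worse than the sweep
  whose direction is decided by a fair coin, `mixtureKernel t (cycle Ks) (cycle Ks.reverse)`.

NOT CLAIMED: any comparison of the forward sweep with the random-SCAN sweep for more than two blocks;
unbounded observables; summability for any run; any number of ours.
-/

noncomputable section

namespace Summit.Ventures.LatticeQCDFlow.Scoring

open MeasureTheory ProbabilityTheory Filter Finset Summit.Ventures.LatticeQCDFlow.Exactness
  Summit.Ventures.LatticeQCDFlow.Scaling
open scoped ENNReal

variable {Ω : Type*} [MeasurableSpace Ω]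

/-! ### §1 Any invariant kernel against a reversible kernel it dominates in Dirichlet form -/

section General

variable {κ σ : Kernel Ω Ω} [IsMarkovKernel κ] [IsMarkovKernel σ] {π : Measure Ω} [IsProbabilityMeasure π]

/-- **`0 ≤ Σ_k autocov κ π g k · rᵏ`** for EVERY Markov kernel with invariant probability law `π`, every
bounded measurable `g` and `0 ≤ r < 1` (no reversibility). -/
theorem abelSum_autocov_nonneg (hinv : Kernel.Invariant κ π) {g : Ω → ℝ} (hg : Measurable g) {Bg : ℝ}
    (hBg : ∀ x, |g x| ≤ Bg) {r : ℝ} (hr0 : 0 ≤ r) (hr1 : r < 1) :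
    0 ≤ ∑' k, autocov κ π g k * r ^ k := by
  have h := RevOp.abelSum_nonneg_nonrev (μ := π) (w := fun _ : Ω => (1 : ℝ))
    (A := fun f : Ω → ℝ => Measurable f ∧ ∃ B, ∀ x, |f x| ≤ B) (K := kop κ) (fun _ => zero_le_one)
    bddMeas_integrable_mul bddMeas_add_mul (kop_bddMeas κ) (kop_lin_bddMeas κ)
    (kop_contr_bddMeas κ hinv) ⟨hg, Bg, hBg⟩ hr0 hr1
  rwa [tsum_integral_mul_iterate_kop_mul_one] at h

/-- **THE KERNEL COMPARISON WITHOUT REVERSIBILITY (Abel form, unconditional).**  `κ` Markov with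
invariant probability law `π`, `σ` a `π`-REVERSIBLE Markov kernel with
`∫ v (kop κ v) dπ ≤ ∫ v (kop σ v) dπ` for every bounded measurable `v` (`𝓔_σ ≤ 𝓔_κ`).  Then for every
bounded measurable `g` and `0 ≤ r < 1`:  `Σ_k autocov κ π g k · rᵏ ≤ Σ_k autocov σ π g k · rᵏ`. -/
theorem abelSum_autocov_le_of_form_le (hinv : Kernel.Invariant κ π) (hσ : Kernel.IsReversible σ π)
    (hdom : ∀ ⦃v : Ω → ℝ⦄, Measurable v → ∀ ⦃B : ℝ⦄, (∀ x, |v x| ≤ B) →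
      ∫ x, v x * kop κ v x ∂π ≤ ∫ x, v x * kop σ v x ∂π)
    {g : Ω → ℝ} (hg : Measurable g) {Bg : ℝ} (hBg : ∀ x, |g x| ≤ Bg) {r : ℝ} (hr0 : 0 ≤ r)
    (hr1 : r < 1) :
    ∑' k, autocov κ π g k * r ^ k ≤ ∑' k, autocov σ π g k * r ^ k := by
  have h := RevOp.abelSum_le_of_quadForm_le_nonrev (μ := π) (w := fun _ : Ω => (1 : ℝ))
    (A := fun f : Ω → ℝ => Measurable f ∧ ∃ B, ∀ x, |f x| ≤ B) (K := kop κ) (S := kop σ)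
    (fun _ => zero_le_one) bddMeas_integrable_mul bddMeas_add_mul (kop_bddMeas κ) (kop_lin_bddMeas κ)
    (kop_contr_bddMeas κ hinv) (kop_bddMeas σ) (kop_lin_bddMeas σ) (kop_symm_bddMeas σ hσ)
    (kop_contr_bddMeas σ hσ.invariant)
    (by
      rintro v ⟨hv, B, hB⟩
      simp only [mul_one]
      exact hdom hv hB)
    ⟨hg, Bg, hBg⟩ hr0 hr1
  rwa [tsum_integral_mul_iterate_kop_mul_one, tsum_integral_mul_iterate_kop_mul_one] at h

/-- **`τ_int(g; κ) ≤ τ_int(g; σ)`** in the setting of `abelSum_autocov_le_of_form_le`, when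
`∫ g² dπ > 0` and both normalised autocorrelation series are summable (`Scoring.tauInt`). -/
theorem tauInt_le_of_form_le (hinv : Kernel.Invariant κ π) (hσ : Kernel.IsReversible σ π)
    (hdom : ∀ ⦃v : Ω → ℝ⦄, Measurable v → ∀ ⦃B : ℝ⦄, (∀ x, |v x| ≤ B) →
      ∫ x, v x * kop κ v x ∂π ≤ ∫ x, v x * kop σ v x ∂π)
    {g : Ω → ℝ} (hg : Measurable g) {Bg : ℝ} (hBg : ∀ x, |g x| ≤ Bg) (hP : 0 < ∫ x, g x ^ 2 ∂π)
    (hsκ : Summable fun n => autocov κ π g (n + 1) / autocov κ π g 0)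
    (hsσ : Summable fun n => autocov σ π g (n + 1) / autocov σ π g 0) :
    tauInt (fun n => autocov κ π g n / autocov κ π g 0)
      ≤ tauInt (fun n => autocov σ π g n / autocov σ π g 0) := by
  have hCκ : autocov κ π g 0 = ∫ x, g x ^ 2 ∂π := autocov_zero κ π g
  have hCσ : autocov σ π g 0 = ∫ x, g x ^ 2 ∂π := autocov_zero σ π g
  have conv : ∀ (η : Kernel Ω Ω) (n : ℕ),
      (∫ x, g x * (kop η)^[n] g x * (fun _ : Ω => (1 : ℝ)) x ∂π) / ∫ x, g x ^ 2 * (fun _ : Ω => (1 : ℝ)) x ∂π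
        = autocov η π g n / ∫ x, g x ^ 2 ∂π := fun η n => by
    rw [integral_mul_iterate_kop_mul_one]; simp only [mul_one]
  have hP' : 0 < ∫ x, g x ^ 2 * (fun _ : Ω => (1 : ℝ)) x ∂π := by simpa only [mul_one] using hP
  have hsκ' : Summable fun n => (∫ x, g x * (kop κ)^[n + 1] g x * (fun _ : Ω => (1 : ℝ)) x ∂π)
      / ∫ x, g x ^ 2 * (fun _ : Ω => (1 : ℝ)) x ∂π :=
    (hsκ.congr fun n => by rw [hCκ]).congr fun n => (conv κ (n + 1)).symm
  have hsσ' : Summable fun n => (∫ x, g x * (kop σ)^[n + 1] g x * (fun _ : Ω => (1 : ℝ)) x ∂π)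
      / ∫ x, g x ^ 2 * (fun _ : Ω => (1 : ℝ)) x ∂π :=
    (hsσ.congr fun n => by rw [hCσ]).congr fun n => (conv σ (n + 1)).symm
  have h := RevOp.tauInt_le_nonrev (μ := π) (w := fun _ : Ω => (1 : ℝ))
    (A := fun f : Ω → ℝ => Measurable f ∧ ∃ B, ∀ x, |f x| ≤ B) (K := kop κ) (S := kop σ)
    (fun _ => zero_le_one) bddMeas_integrable_mul bddMeas_add_mul (kop_bddMeas κ) (kop_lin_bddMeas κ)
    (kop_contr_bddMeas κ hinv) (kop_bddMeas σ) (kop_lin_bddMeas σ) (kop_symm_bddMeas σ hσ)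
    (kop_contr_bddMeas σ hσ.invariant)
    (by
      rintro v ⟨hv, B, hB⟩
      simp only [mul_one]
      exact hdom hv hB)
    ⟨hg, Bg, hBg⟩ hP' hsκ' hsσ'
  have e1 : (fun n => (∫ x, g x * (kop κ)^[n] g x * (fun _ : Ω => (1 : ℝ)) x ∂π)
      / ∫ x, g x ^ 2 * (fun _ : Ω => (1 : ℝ)) x ∂π) = fun n => autocov κ π g n / autocov κ π g 0 := by
    funext n; rw [conv, hCκ]
  have e2 : (fun n => (∫ x, g x * (kop σ)^[n] g x * (fun _ : Ω => (1 : ℝ)) x ∂π)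
      / ∫ x, g x ^ 2 * (fun _ : Ω => (1 : ℝ)) x ∂π) = fun n => autocov σ π g n / autocov σ π g 0 := by
    funext n; rw [conv, hCσ]
  rwa [e1, e2] at h

end General

/-! ### §2 Against the additive reversibilization `½(κ + κ†)` -/

section Reversibilization

variable {κ κ' : Kernel Ω Ω} [IsMarkovKernel κ] [IsMarkovKernel κ'] {π : Measure Ω}
  [IsProbabilityMeasure π]

/-- **A KERNEL NEVER SCORES WORSE THAN ITS ADDITIVE REVERSIBILIZATION (Abel form, unconditional).**
`(κ, κ')` a `π`-adjoint pair of Markov kernels, `(t : ℝ) = ½`: for every bounded measurable `g` and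
`0 ≤ r < 1`, `Σ_k autocov κ π g k rᵏ ≤ Σ_k autocov (mixtureKernel t κ κ') π g k rᵏ`. -/
theorem abelSum_autocov_le_addReversibilization (h : IsAdjointPair κ κ' π) (t : unitInterval)
    (ht : (t : ℝ) = 1 / 2) {g : Ω → ℝ} (hg : Measurable g) {Bg : ℝ} (hBg : ∀ x, |g x| ≤ Bg) {r : ℝ}
    (hr0 : 0 ≤ r) (hr1 : r < 1) :
    ∑' k, autocov κ π g k * r ^ k ≤ ∑' k, autocov (mixtureKernel t κ κ') π g k * r ^ k :=
  abelSum_autocov_le_of_form_le h.invariant (isReversible_mixtureKernel_of_isAdjointPair h t ht)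
    (fun _ hv _ hB => (integral_mul_kop_mixtureKernel_of_isAdjointPair h t hv hB).symm.le) hg hBg hr0 hr1

/-- **`τ_int(g; κ) ≤ τ_int(g; ½(κ + κ†))`** under summability of both normalised series, `∫ g² dπ > 0`. -/
theorem tauInt_le_addReversibilization (h : IsAdjointPair κ κ' π) (t : unitInterval)
    (ht : (t : ℝ) = 1 / 2) {g : Ω → ℝ} (hg : Measurable g) {Bg : ℝ} (hBg : ∀ x, |g x| ≤ Bg)
    (hP : 0 < ∫ x, g x ^ 2 ∂π)
    (hsκ : Summable fun n => autocov κ π g (n + 1) / autocov κ π g 0)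
    (hsσ : Summable fun n =>
      autocov (mixtureKernel t κ κ') π g (n + 1) / autocov (mixtureKernel t κ κ') π g 0) :
    tauInt (fun n => autocov κ π g n / autocov κ π g 0)
      ≤ tauInt (fun n => autocov (mixtureKernel t κ κ') π g n / autocov (mixtureKernel t κ κ') π g 0) :=
  tauInt_le_of_form_le h.invariant (isReversible_mixtureKernel_of_isAdjointPair h t ht)
    (fun _ hv _ hB => (integral_mul_kop_mixtureKernel_of_isAdjointPair h t hv hB).symm.le) hg hBg hP
    hsκ hsσ

end Reversibilization

/-! ### §3 Sweeps: forward beats the fair forward/backward coin -/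

section Sweeps

variable {π : Measure Ω} [IsProbabilityMeasure π]

/-- **THE FORWARD SWEEP NEVER SCORES WORSE THAN THE DIRECTION-RANDOMISED SWEEP (Abel form,
unconditional).**  `Ks` a list of `π`-reversible Markov kernels, `(t : ℝ) = ½`; for every bounded
measurable `g` and `0 ≤ r < 1`:
`Σ_k autocov (cycle Ks) π g k rᵏ ≤ Σ_k autocov (mixtureKernel t (cycle Ks) (cycle Ks.reverse)) π g k rᵏ`. -/
theorem abelSum_autocov_cycle_le_directionMixture {Ks : List (Kernel Ω Ω)}
    (hM : ∀ κ ∈ Ks, IsMarkovKernel κ) (hrev : ∀ κ ∈ Ks, Kernel.IsReversible κ π) (t : unitInterval)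
    (ht : (t : ℝ) = 1 / 2) {g : Ω → ℝ} (hg : Measurable g) {Bg : ℝ} (hBg : ∀ x, |g x| ≤ Bg) {r : ℝ}
    (hr0 : 0 ≤ r) (hr1 : r < 1) :
    (haveI := isMarkovKernel_cycle hM
     haveI : IsMarkovKernel (cycle Ks.reverse) :=
       isMarkovKernel_cycle fun η hη => hM η (List.mem_reverse.mp hη)
     ∑' k, autocov (cycle Ks) π g k * r ^ k
       ≤ ∑' k, autocov (mixtureKernel t (cycle Ks) (cycle Ks.reverse)) π g k * r ^ k) := by
  haveI := isMarkovKernel_cycle hM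
  haveI : IsMarkovKernel (cycle Ks.reverse) :=
    isMarkovKernel_cycle fun η hη => hM η (List.mem_reverse.mp hη)
  exact abelSum_autocov_le_addReversibilization (isAdjointPair_cycle_reverse hM hrev) t ht hg hBg hr0 hr1

/-- **`τ_int(g; forward sweep) ≤ τ_int(g; direction-randomised sweep)`** under summability of both
normalised series and `∫ g² dπ > 0`. -/
theorem tauInt_cycle_le_directionMixture {Ks : List (Kernel Ω Ω)}
    (hM : ∀ κ ∈ Ks, IsMarkovKernel κ) (hrev : ∀ κ ∈ Ks, Kernel.IsReversible κ π) (t : unitInterval)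
    (ht : (t : ℝ) = 1 / 2) {g : Ω → ℝ} (hg : Measurable g) {Bg : ℝ} (hBg : ∀ x, |g x| ≤ Bg)
    (hP : 0 < ∫ x, g x ^ 2 ∂π)
    (hs : haveI := isMarkovKernel_cycle hM
      Summable fun n => autocov (cycle Ks) π g (n + 1) / autocov (cycle Ks) π g 0)
    (hs' : haveI := isMarkovKernel_cycle hM
      haveI : IsMarkovKernel (cycle Ks.reverse) :=
        isMarkovKernel_cycle fun η hη => hM η (List.mem_reverse.mp hη)
      Summable fun n => autocov (mixtureKernel t (cycle Ks) (cycle Ks.reverse)) π g (n + 1)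
        / autocov (mixtureKernel t (cycle Ks) (cycle Ks.reverse)) π g 0) :
    (haveI := isMarkovKernel_cycle hM
     haveI : IsMarkovKernel (cycle Ks.reverse) :=
       isMarkovKernel_cycle fun η hη => hM η (List.mem_reverse.mp hη)
     tauInt (fun n => autocov (cycle Ks) π g n / autocov (cycle Ks) π g 0)
       ≤ tauInt (fun n => autocov (mixtureKernel t (cycle Ks) (cycle Ks.reverse)) π g n
           / autocov (mixtureKernel t (cycle Ks) (cycle Ks.reverse)) π g 0)) := by
  haveI := isMarkovKernel_cycle hM
  haveI : IsMarkovKernel (cycle Ks.reverse) :=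
    isMarkovKernel_cycle fun η hη => hM η (List.mem_reverse.mp hη)
  exact tauInt_le_addReversibilization (isAdjointPair_cycle_reverse hM hrev) t ht hg hBg hP hs hs'

end Sweeps

end Summit.Ventures.LatticeQCDFlow.Scoring
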